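import Summits.QuantumFields.YangMills.Theorems.TwistedTraceScaling.Negative.ClockRigidity
import Summits.QuantumFields.YangMills.Theorems.FemtoCutoffLadderWindowCoupling
import HarnessLib

/-!
# `TwistedTraceScaling` (crux stmt-QuantumFields-20203, route `LuscherReduction`, skeleton «twolattice» rev 3):
# negative-side support R80 — the LARGE-FIELD ENTROPY THRESHOLD `1/b₀ = 24π²/11` on the two-loop femto window
# (refuter crux-disprover seat; this file does NOT refute the crux)

HONEST FRAMING: `TwistedTraceScaling` is a femto-rung (R2b1) crux of a CONDITIONAL reduction route; its one open stub is
`Stmt.stub_cmpTwoLoop` (≡ LIM, `R75.cmpTwoLoop_iff_labelLimit`; open content one swap `∃ Λ0 ∀ L`, pointwise in `L` a theorem,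
`R75c.labelLimit_pointwise`).  Not infinite volume, not a mass gap, not Clay.  Objects are the tree's (`b0`, `b1`, `invRunningCoupling`,
`luscherLambda`, `InFemtoWindow`, `TraceDoor.femtoSteps`); no definition, no `Theses` import, no `sorry`.  Notation: `W(lam, L)` = the window
`InFemtoWindow lam · L` (`1 ≤ β`, `lam ≤ Λ ≤ 2 lam`), `T_s = femtoSteps s β L = ⌈sL/Λ⌉₊`.

WHAT IS CERTIFIED (architecture facts for any CMP-2LOOP ∕ LIM supplier; elementary real analysis on the window labels).
* §2 ★ THE WINDOW IS THE TWO-LOOP SCALING TRAJECTORY, TWO-SIDED: the tree has `4b₀ log L < β` on `W(lam, L)`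
  (`four_b0_log_lt_beta_of_window`); here, for every `θ > 0`, `β ≤ (4b₀ + θ) log L + C(θ, lam)` on `W(lam, L)` for all `L`
  (`beta_le_of_window_sharp`; `log log` form `beta_le_of_window_loglog`).  So `β/log L → 4b₀` uniformly on the window and
  `L⁴ = e^{(β/b₀)(1 + o(1))}`: the cutoff 4-volume of the femto universe is `a(β)⁻⁴ ∝ e^{β/b₀}` (asymptotic scaling, tree label `sizeLog`).
* §3 ★★ THE ENTROPY THRESHOLD.  For a fixed action defect `δ ≥ 0` (tree weight `e^{−βS}`, `S = Σ_p (N − Re tr U_p)`: ONE plaquette raised by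
  `δ` costs `e^{−δβ}`): `L^{4 − 4b₀δ − θ} ≤ L⁴ e^{−δβ} ≤ L^{4 − 4b₀δ}` on `W(lam, L)` (upper: all `L`; lower: any `θ > 0`, eventually in `L`;
  `fourVolume_defect_le ∕ _ge`).  Threshold `δ* = 1/b₀ = 24π²/11 ∈ (21, 22)` (`inv_b0_eq`, `inv_b0_bounds`): for `δ < 1/b₀` the weight
  `L⁴e^{−δβ}` — and the femto 4-volume weight `L³ · T_s · e^{−δβ}`, `T_s ≥ sL/(2 lam)` — is UNBOUNDED along the window
  (`fourVolume_defect_unbounded`, `femtoVolume_defect_unbounded`), for `δ > 1/b₀` it tends to `0` (`…_small`); summary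
  `window_entropy_threshold`.  In instanton units (`S_inst = 4π²β` here) `δ*` is `6/11` of the one-instanton action: the number of the
  Pugh–Teper «entropy bound» `48π²/11` of the dislocation literature (Pugh–Teper, Phys. Lett. B 224 (1989) 159; quoted in de Forcrand et al.,
  hep-lat/9812006, p. 7).
* §3 ★ CUTOFF-SCALE LARGE FIELDS ARE ABUNDANT ON THE WINDOW: one `SU(2)` plaquette costs at most `δ = 2N = 4 < 21 < 1/b₀` (`four_lt_inv_b0`,
  `sixteen_b0_lt_one`), so for EVERY per-plaquette event (`0 ≤ δ ≤ 4`) `L³ ≤ L⁴e^{−δβ}` eventually on the window (`cutoffScale_defect_ge_cube`):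
  the union bound «plaquettes × worst Boltzmann factor» diverges like a power of `L`, maximal defect included.  READING: no single-scale
  argument «small-field expansion + large fields suppressed by (4-volume)·e^{−pβ}» with `p` independent of `L` can supply CMP-2LOOP ∕ LIM on
  the window; cutoff-scale large fields must be renormalised scale by scale (their irrelevance is a power of `a/ℓ = 1/L`, not a Boltzmann
  factor) — the planners' «NOT DECOMPOSED YET: multi-scale» made quantitative, with the threshold on both sides.  This constrains PROOFS, not
  the statement; it refutes nothing.
* §4 CONTRAST: at FIXED `L`, `L⁴e^{−δβ} → 0` as `β → ∞` for every `δ > 0` (`fourVolume_defect_tendsto_zero_fixedL`) — the S-BASE regime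
  (closed stub) is entropy-free, the window regime is not: one more face of `∀ L ∃` versus `∃ ∀ L`.  §5: the window is inhabited at every
  depth `lam ∈ (0, 1]` on every lattice (`exists_inFemtoWindow`), so §3 is witnessed (`exists_window_point_ge`).
Nearest tree fact: `WindowCoupling.beta_le_of_window` (route `FemtoCutoffLadder`), `β ≤ 13(1/lam³ + 2b₀ log L)` — its coefficient `26b₀` on
`log L` yields divergence only for `δ < 2/(13b₀)`; the sharp `4b₀ + θ` here gives the true threshold and the matching upper side.
-/

set_option autoImplicit false

noncomputable section

open MeasureTheory Filter Topology Real
open Literature.MathematicalPhysics.QuantumFieldTheory hiding SU2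
open Literature.MathematicalPhysics.QuantumLattice
open Literature.Analysis.OperatorTheory.YMMatrixModel
open scoped BigOperators

namespace Summit.QuantumFields.YangMills.Theorems.TwistedTraceScaling.Negative.R80

open Summit.QuantumFields.YangMills.Theorems.FemtoTransferGap
open Summit.QuantumFields.YangMills.Theorems.FemtoTransferGap.TraceDoor

/-! ## §1 The number `1/b₀ = 24π²/11` -/

/-- `1/b₀ = 24π²/11` (`b₀ = 11/(24π²)`, `SU(2)`, tree normalisation `β = β_Wilson/2`). [cite: LuscherMunster1984, §2] -/
theorem inv_b0_eq : 1 / b0 = 24 * π ^ 2 / 11 := by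
  unfold b0
  rw [one_div, inv_div]

/-- `21 < 1/b₀ < 22` (`π ∈ (3.14, 3.15)`). [folklore] -/
theorem inv_b0_bounds : (21 : ℝ) < 1 / b0 ∧ 1 / b0 < 22 := by
  rw [inv_b0_eq]
  have h1 : (3.14 : ℝ) < π := Real.pi_gt_d2
  have h2 : π < (3.15 : ℝ) := Real.pi_lt_d2
  have hπ : 0 < π := Real.pi_pos
  have h3 : (3.14 : ℝ) * 3.14 < π * π := mul_lt_mul'' h1 h1 (by norm_num) (by norm_num)
  have h4 : π * π < 3.15 * 3.15 := mul_lt_mul'' h2 h2 hπ.le hπ.le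
  constructor
  · rw [lt_div_iff₀ (by norm_num)]; nlinarith
  · rw [div_lt_iff₀ (by norm_num)]; nlinarith

/-- The maximal single-plaquette defect `2N = 4` of `SU(2)` is far below the entropy threshold: `4 < 1/b₀`. [folklore] -/
theorem four_lt_inv_b0 : (4 : ℝ) < 1 / b0 := by linarith [inv_b0_bounds.1]

/-- Moreover `16 b₀ < 1` (`1/b₀ > 21 > 16`): the `L`-exponent `4 − 4b₀δ` stays `> 3` for every per-plaquette defect `δ ≤ 4`. [folklore] -/
theorem sixteen_b0_lt_one : 16 * b0 < 1 := by
  have hb0 : 0 < b0 := by unfold b0; positivity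
  have h := inv_b0_bounds.1
  rw [lt_div_iff₀ hb0] at h
  linarith

/-- `x⁴ = e^{4 log x}` for `x > 0`. [folklore] -/
theorem pow_four_eq_exp {x : ℝ} (hx : 0 < x) : x ^ 4 = Real.exp (4 * Real.log x) := by
  rw [show (4 : ℝ) * Real.log x = ((4 : ℕ) : ℝ) * Real.log x by norm_num, Real.exp_nat_mul, Real.exp_log hx]

/-! ## §2 On the window the bare coupling follows the two-loop scaling trajectory `β = 4b₀ log L · (1 + o(1))` -/

/-- The window's label bound `1/ḡ² ≤ 1/lam³`, spelled out: `β/2 ≤ 1/lam³ + 2b₀ log L + (b₁/b₀) log(β/(2b₀))`. [cite: LuscherMunster1984, §2] -/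
theorem half_beta_le_of_window {lam β : ℝ} {L : ℕ} (hlam : 0 < lam) (hW : InFemtoWindow lam β L) :
    β / 2 ≤ 1 / lam ^ 3 + 2 * b0 * Real.log L + (b1 / b0) * Real.log (β / (2 * b0)) := by
  have h := (invRunningCoupling_le_of_window hlam hW).2
  rw [BOHandover.invRunningCoupling_eq] at h
  have hlog : Real.log (2 * b0 / β) = -Real.log (β / (2 * b0)) := by
    rw [← inv_div, Real.log_inv]
  rw [hlog] at h
  linarith

/-- `log y ≤ y/K + log K − 1` for `K, y > 0` (`log(y/K) ≤ y/K − 1`). [folklore] -/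
theorem log_le_div_add_log_sub_one {K y : ℝ} (hK : 0 < K) (hy : 0 < y) :
    Real.log y ≤ y / K + Real.log K - 1 := by
  have h1 : Real.log (y / K) ≤ y / K - 1 := Real.log_le_sub_one_of_pos (div_pos hy hK)
  rw [Real.log_div hy.ne' hK.ne'] at h1
  linarith

/-- The `K`-form of the upper bound: `β (1/2 − 51/(121K)) ≤ 1/lam³ + 2b₀ log L + (b₁/b₀)(log K − 1)` on the window, for every `K > 0`
(`(b₁/b₀)·β/(2b₀K) = (51/121) β/K`, `b₁/(2b₀²) = 51/121`). [cite: HasenfratzHasenfratz1980, p. 165] -/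
theorem beta_mul_le_of_window {K lam β : ℝ} {L : ℕ} (hK : 0 < K) (hlam : 0 < lam) (hW : InFemtoWindow lam β L) :
    β * (1 / 2 - 51 / (121 * K)) ≤ 1 / lam ^ 3 + 2 * b0 * Real.log L + (b1 / b0) * (Real.log K - 1) := by
  have hb0 : 0 < b0 := by unfold b0; positivity
  have hb1 : 0 < b1 := by unfold b1; positivity
  have hβ0 : 0 < β := by linarith [hW.1]
  have h1 := half_beta_le_of_window hlam hW
  have h2 := log_le_div_add_log_sub_one hK (show 0 < β / (2 * b0) by positivity)
  have h3 : (b1 / b0) * Real.log (β / (2 * b0)) ≤ (b1 / b0) * (β / (2 * b0) / K + Real.log K - 1) :=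
    mul_le_mul_of_nonneg_left h2 (div_pos hb1 hb0).le
  have h4 : (b1 / b0) * (β / (2 * b0) / K) = (b1 / (2 * b0 ^ 2)) * β / K := by
    field_simp
  rw [TwoLattice.Base.b1_div_two_b0_sq'] at h4
  have h5 : (b1 / b0) * (β / (2 * b0) / K + Real.log K - 1)
      = (b1 / b0) * (β / (2 * b0) / K) + (b1 / b0) * (Real.log K - 1) := by ring
  rw [h5, h4] at h3
  have h6 : β * (1 / 2 - 51 / (121 * K)) = β / 2 - 51 / 121 * β / K := by ring
  rw [h6]
  linarith

/-- ★ **The window is the two-loop scaling trajectory (sharp upper side)**: for every slack `θ > 0` there is `C = C(θ, lam)` with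
`β ≤ (4b₀ + θ) log L + C` at every point of `W(lam, L)`, every `L` (take `K = 102(4b₀+θ)/(121θ)` in `beta_mul_le_of_window`, so that
`(4b₀+θ)(1/2 − 51/(121K)) = 2b₀`).  With the tree's `4b₀ log L < β` this is `β/log L → 4b₀` uniformly on the window. [cite: LuscherMunster1984, §2] -/
theorem beta_le_of_window_sharp {θ lam : ℝ} (hθ : 0 < θ) (hlam : 0 < lam) :
    ∃ C : ℝ, ∀ (L : ℕ) [NeZero L] (β : ℝ), InFemtoWindow lam β L → β ≤ (4 * b0 + θ) * Real.log L + C := by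
  have hb0 : 0 < b0 := by unfold b0; positivity
  obtain ⟨K, hKpos, hKc⟩ : ∃ K : ℝ, 0 < K ∧ 2 * b0 ≤ (4 * b0 + θ) * (1 / 2 - 51 / (121 * K)) := by
    refine ⟨102 * (4 * b0 + θ) / (121 * θ), by positivity, le_of_eq ?_⟩
    have h1 : 4 * b0 + θ ≠ 0 := by positivity
    have h2 : θ ≠ 0 := hθ.ne'
    field_simp
    ring
  have hcpos : 0 < 1 / 2 - 51 / (121 * K) := by
    have h1 : (4 * b0 + θ) * (51 / (121 * K)) < (4 * b0 + θ) * (1 / 2) := by nlinarith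
    have h2 := lt_of_mul_lt_mul_left h1 (by positivity : (0 : ℝ) ≤ 4 * b0 + θ)
    linarith
  refine ⟨(1 / lam ^ 3 + (b1 / b0) * (Real.log K - 1)) / (1 / 2 - 51 / (121 * K)), fun L _ β hW => ?_⟩
  have hmain := beta_mul_le_of_window hKpos hlam hW
  have hlog0 : 0 ≤ Real.log (L : ℝ) := Real.log_nonneg (by exact_mod_cast NeZero.one_le)
  rw [← sub_le_iff_le_add', le_div_iff₀ hcpos]
  have h2 : 2 * b0 * Real.log L ≤ (4 * b0 + θ) * (1 / 2 - 51 / (121 * K)) * Real.log L :=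
    mul_le_mul_of_nonneg_right hKc hlog0
  nlinarith [hmain, h2]

/-- **Explicit `log log` form**: `β ≤ 4b₀ log L + 2/lam³ + (2b₁/b₀) log(13(1/lam³ + 2b₀ log L)/(2b₀))` on the window (insert the crude
bound `β ≤ 13(1/lam³ + 2b₀ log L)` of `WindowCoupling.beta_le_of_window` into the logarithm of `half_beta_le_of_window`).  So along the
window `β = 4b₀ log L + O(log log L)`, the two-loop scaling trajectory. [cite: LuscherMunster1984, §2] -/
theorem beta_le_of_window_loglog {lam β : ℝ} {L : ℕ} [NeZero L] (hlam : 0 < lam) (hW : InFemtoWindow lam β L) :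
    β ≤ 4 * b0 * Real.log L + 2 / lam ^ 3
      + (2 * b1 / b0) * Real.log (13 * (1 / lam ^ 3 + 2 * b0 * Real.log L) / (2 * b0)) := by
  have hb0 : 0 < b0 := by unfold b0; positivity
  have hb1 : 0 < b1 := by unfold b1; positivity
  have hβ0 : 0 < β := by linarith [hW.1]
  have h1 := half_beta_le_of_window hlam hW
  have h13 := WindowCoupling.beta_le_of_window hlam hW
  have hlog : Real.log (β / (2 * b0)) ≤ Real.log (13 * (1 / lam ^ 3 + 2 * b0 * Real.log L) / (2 * b0)) := by
    apply Real.log_le_log (by positivity)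
    exact div_le_div_of_nonneg_right h13 (by positivity)
  have h2 : (b1 / b0) * Real.log (β / (2 * b0))
      ≤ (b1 / b0) * Real.log (13 * (1 / lam ^ 3 + 2 * b0 * Real.log L) / (2 * b0)) :=
    mul_le_mul_of_nonneg_left hlog (div_pos hb1 hb0).le
  have h3 : (2 * b1 / b0) * Real.log (13 * (1 / lam ^ 3 + 2 * b0 * Real.log L) / (2 * b0))
      = 2 * ((b1 / b0) * Real.log (13 * (1 / lam ^ 3 + 2 * b0 * Real.log L) / (2 * b0))) := by ring
  have h4 : (2 : ℝ) / lam ^ 3 = 2 * (1 / lam ^ 3) := by ring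
  rw [h3, h4]
  linarith

/-- ★ **Two-sided pinning of the bare coupling on the window**: for every `θ > 0` there is `C` with
`4b₀ log L < β ≤ (4b₀ + θ) log L + C` on `W(lam, L)` for every `L ≥ 1`. [cite: LuscherMunster1984, §2] -/
theorem beta_window_two_sided {θ lam : ℝ} (hθ : 0 < θ) (hlam : 0 < lam) :
    ∃ C : ℝ, ∀ (L : ℕ) [NeZero L] (β : ℝ), InFemtoWindow lam β L →
      4 * b0 * Real.log L < β ∧ β ≤ (4 * b0 + θ) * Real.log L + C := by
  obtain ⟨C, hC⟩ := beta_le_of_window_sharp hθ hlam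
  exact ⟨C, fun L _ β hW => ⟨four_b0_log_lt_beta_of_window hlam hW, hC L β hW⟩⟩

/-! ## §3 The entropy threshold `1/b₀` for a fixed action defect against the (femto) 4-volume -/

/-- **Upper power law** (all window points): `L⁴ e^{−δβ} ≤ L^{4 − 4b₀δ}` for `δ ≥ 0` (from `β > 4b₀ log L`). [folklore] -/
theorem fourVolume_defect_le {δ lam β : ℝ} {L : ℕ} [NeZero L] (hδ : 0 ≤ δ) (hlam : 0 < lam) (hW : InFemtoWindow lam β L) :
    (L : ℝ) ^ 4 * Real.exp (-(δ * β)) ≤ (L : ℝ) ^ (4 - 4 * b0 * δ : ℝ) := by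
  have hL : (0 : ℝ) < L := by exact_mod_cast Nat.pos_of_ne_zero (NeZero.ne L)
  have hβ := four_b0_log_lt_beta_of_window hlam hW
  rw [Real.rpow_def_of_pos hL, pow_four_eq_exp hL, ← Real.exp_add, Real.exp_le_exp]
  have h1 : δ * (4 * b0 * Real.log L) ≤ δ * β := mul_le_mul_of_nonneg_left hβ.le hδ
  nlinarith [h1]

/-- ★ **Lower power law** (eventually in `L`, uniformly on the window): for `δ ≥ 0` and every `θ > 0`,
`L^{4 − 4b₀δ − θ} ≤ L⁴ e^{−δβ}` on `W(lam, L)` for all large `L` (from `β ≤ (4b₀ + θ′) log L + C`, `θ′ = θ/(2(δ+1))`). [folklore] -/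
theorem fourVolume_defect_ge {δ θ lam : ℝ} (hδ : 0 ≤ δ) (hθ : 0 < θ) (hlam : 0 < lam) :
    ∃ L1 : ℕ, ∀ (L : ℕ) [NeZero L], L1 ≤ L → ∀ β : ℝ, InFemtoWindow lam β L →
      (L : ℝ) ^ (4 - 4 * b0 * δ - θ : ℝ) ≤ (L : ℝ) ^ 4 * Real.exp (-(δ * β)) := by
  obtain ⟨θ', hθ'pos, hθ'le⟩ : ∃ θ' : ℝ, 0 < θ' ∧ δ * θ' ≤ θ / 2 := by
    refine ⟨θ / (2 * (δ + 1)), by positivity, ?_⟩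
    rw [mul_div_assoc', div_le_div_iff₀ (by positivity) (by norm_num)]
    nlinarith
  obtain ⟨C, hC⟩ := beta_le_of_window_sharp hθ'pos hlam
  refine ⟨⌈Real.exp (2 * δ * C / θ)⌉₊, fun L _ hL β hW => ?_⟩
  have hLpos : (0 : ℝ) < L := by exact_mod_cast Nat.pos_of_ne_zero (NeZero.ne L)
  have hβle := hC L β hW
  have hL1 : Real.exp (2 * δ * C / θ) ≤ (L : ℝ) := (Nat.le_ceil _).trans (by exact_mod_cast hL)
  have hlogL : 2 * δ * C / θ ≤ Real.log (L : ℝ) := by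
    rw [Real.le_log_iff_exp_le hLpos]; exact hL1
  rw [div_le_iff₀ hθ] at hlogL
  have hlog0 : 0 ≤ Real.log (L : ℝ) := Real.log_nonneg (by exact_mod_cast NeZero.one_le)
  rw [Real.rpow_def_of_pos hLpos, pow_four_eq_exp hLpos, ← Real.exp_add, Real.exp_le_exp]
  have h1 : δ * β ≤ δ * ((4 * b0 + θ') * Real.log L + C) := mul_le_mul_of_nonneg_left hβle hδ
  have h4 : δ * θ' * Real.log L ≤ θ / 2 * Real.log L := mul_le_mul_of_nonneg_right hθ'le hlog0
  nlinarith [h1, h4, hlogL]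

/-- ★★ **Below threshold the 4-volume beats the Boltzmann factor**: for `δ < 1/b₀ = 24π²/11`, `L⁴ e^{−δβ}` is unbounded along the window —
for every `M`, `M ≤ L⁴ e^{−δβ}` on `W(lam, L)` for all large `L`. [folklore] -/
theorem fourVolume_defect_unbounded {δ lam : ℝ} (hδ : δ < 1 / b0) (hlam : 0 < lam) (M : ℝ) :
    ∃ L1 : ℕ, ∀ (L : ℕ) [NeZero L], L1 ≤ L → ∀ β : ℝ, InFemtoWindow lam β L →
      M ≤ (L : ℝ) ^ 4 * Real.exp (-(δ * β)) := by
  have hb0 : 0 < b0 := by unfold b0; positivity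
  have hd0 : 0 ≤ max δ 0 := le_max_right _ _
  have hd1 : max δ 0 < 1 / b0 := max_lt hδ (by positivity)
  have hκ : 0 < 4 - 4 * b0 * max δ 0 := by
    have : b0 * max δ 0 < 1 := by rwa [lt_div_iff₀' hb0] at hd1
    linarith
  obtain ⟨L1, hL1⟩ := fourVolume_defect_ge hd0 (half_pos hκ) hlam
  refine ⟨max L1 ⌈Real.exp (2 * (M - 1) / (4 - 4 * b0 * max δ 0))⌉₊, fun L _ hL β hW => ?_⟩
  have hLpos : (0 : ℝ) < L := by exact_mod_cast Nat.pos_of_ne_zero (NeZero.ne L)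
  have hge := hL1 L ((le_max_left _ _).trans hL) β hW
  have hL2 : Real.exp (2 * (M - 1) / (4 - 4 * b0 * max δ 0)) ≤ (L : ℝ) :=
    (Nat.le_ceil _).trans (by exact_mod_cast (le_max_right _ _).trans hL)
  have hlogL : 2 * (M - 1) / (4 - 4 * b0 * max δ 0) ≤ Real.log (L : ℝ) := by
    rw [Real.le_log_iff_exp_le hLpos]; exact hL2
  rw [div_le_iff₀ hκ] at hlogL
  have hM : M ≤ (L : ℝ) ^ (4 - 4 * b0 * max δ 0 - (4 - 4 * b0 * max δ 0) / 2 : ℝ) := by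
    rw [Real.rpow_def_of_pos hLpos]
    have h1 := Real.add_one_le_exp (Real.log L * (4 - 4 * b0 * max δ 0 - (4 - 4 * b0 * max δ 0) / 2))
    nlinarith [h1, hlogL]
  have hβ0 : 0 ≤ β := by linarith [hW.1]
  have hexp : Real.exp (-(max δ 0 * β)) ≤ Real.exp (-(δ * β)) := by
    rw [Real.exp_le_exp]
    nlinarith [le_max_left δ 0]
  calc M ≤ _ := hM
    _ ≤ (L : ℝ) ^ 4 * Real.exp (-(max δ 0 * β)) := hge
    _ ≤ (L : ℝ) ^ 4 * Real.exp (-(δ * β)) := mul_le_mul_of_nonneg_left hexp (by positivity)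

/-- ★★ **Above threshold the Boltzmann factor beats the 4-volume**: for `δ > 1/b₀`, `L⁴ e^{−δβ} → 0` along the window — for every
`ε > 0`, `L⁴ e^{−δβ} ≤ ε` on `W(lam, L)` for all large `L`. [folklore] -/
theorem fourVolume_defect_small {δ lam ε : ℝ} (hδ : 1 / b0 < δ) (hlam : 0 < lam) (hε : 0 < ε) :
    ∃ L1 : ℕ, ∀ (L : ℕ) [NeZero L], L1 ≤ L → ∀ β : ℝ, InFemtoWindow lam β L →
      (L : ℝ) ^ 4 * Real.exp (-(δ * β)) ≤ ε := by
  have hb0 : 0 < b0 := by unfold b0; positivity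
  have hδ0 : 0 ≤ δ := le_of_lt (lt_trans (by positivity : (0 : ℝ) < 1 / b0) hδ)
  have hκ : 0 < 4 * b0 * δ - 4 := by
    have : 1 < b0 * δ := by rwa [div_lt_iff₀' hb0] at hδ
    linarith
  refine ⟨⌈Real.exp (-Real.log ε / (4 * b0 * δ - 4))⌉₊, fun L _ hL β hW => ?_⟩
  have hLpos : (0 : ℝ) < L := by exact_mod_cast Nat.pos_of_ne_zero (NeZero.ne L)
  refine (fourVolume_defect_le hδ0 hlam hW).trans ?_
  have hL2 : Real.exp (-Real.log ε / (4 * b0 * δ - 4)) ≤ (L : ℝ) := (Nat.le_ceil _).trans (by exact_mod_cast hL)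
  have hlogL : -Real.log ε / (4 * b0 * δ - 4) ≤ Real.log (L : ℝ) := by
    rw [Real.le_log_iff_exp_le hLpos]; exact hL2
  rw [div_le_iff₀ hκ] at hlogL
  rw [Real.rpow_def_of_pos hLpos]
  calc Real.exp (Real.log L * (4 - 4 * b0 * δ)) ≤ Real.exp (Real.log ε) := by
        rw [Real.exp_le_exp]; nlinarith [hlogL]
    _ = ε := Real.exp_log hε

/-- ★★ **THE ENTROPY THRESHOLD ON THE TWO-LOOP FEMTO WINDOW IS `1/b₀ = 24π²/11`** (summary of the two sides): a fixed action defect `δ`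
against the cutoff 4-volume `L⁴` is entropically dominant (`L⁴e^{−δβ} → ∞`) for `δ < 1/b₀` and negligible (`→ 0`) for `δ > 1/b₀`,
uniformly on `W(lam, L)` as `L → ∞`, at every depth `lam > 0`. [folklore] -/
theorem window_entropy_threshold {lam : ℝ} (hlam : 0 < lam) (δ : ℝ) :
    (δ < 1 / b0 → ∀ M : ℝ, ∃ L1 : ℕ, ∀ (L : ℕ) [NeZero L], L1 ≤ L → ∀ β : ℝ, InFemtoWindow lam β L →
        M ≤ (L : ℝ) ^ 4 * Real.exp (-(δ * β))) ∧
    (1 / b0 < δ → ∀ ε : ℝ, 0 < ε → ∃ L1 : ℕ, ∀ (L : ℕ) [NeZero L], L1 ≤ L → ∀ β : ℝ, InFemtoWindow lam β L →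
        (L : ℝ) ^ 4 * Real.exp (-(δ * β)) ≤ ε) :=
  ⟨fun h M => fourVolume_defect_unbounded h hlam M, fun h _ hε => fourVolume_defect_small h hlam hε⟩

/-- On the window the femto time extent is at least `sL/(2 lam)` lattice steps (`T_s = ⌈sL/Λ⌉₊`, `Λ ≤ 2 lam`). [folklore] -/
theorem femtoSteps_ge_of_window {s lam β : ℝ} {L : ℕ} (hs : 0 ≤ s) (hlam : 0 < lam) (hW : InFemtoWindow lam β L) :
    s * L / (2 * lam) ≤ (femtoSteps s β L : ℝ) := by
  have hl : 0 < luscherLambda β L := luscherLambda_pos_of_window hlam hW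
  unfold femtoSteps
  refine le_trans ?_ (Nat.le_ceil _)
  exact div_le_div_of_nonneg_left (by positivity) hl hW.2.2

/-- On the window the femto time extent is at most `sL/lam + 1` lattice steps (`Λ ≥ lam`). [folklore] -/
theorem femtoSteps_le_of_window {s lam β : ℝ} {L : ℕ} (hs : 0 ≤ s) (hlam : 0 < lam) (hW : InFemtoWindow lam β L) :
    (femtoSteps s β L : ℝ) ≤ s * L / lam + 1 := by
  have hl : 0 < luscherLambda β L := luscherLambda_pos_of_window hlam hW
  unfold femtoSteps
  have h0 : 0 ≤ s * L / luscherLambda β L := by positivity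
  have h1 : (⌈s * (L : ℝ) / luscherLambda β L⌉₊ : ℝ) < s * L / luscherLambda β L + 1 := Nat.ceil_lt_add_one h0
  have h2 : s * L / luscherLambda β L ≤ s * L / lam := div_le_div_of_nonneg_left (by positivity) hlam hW.2.1
  linarith

/-- ★★ **Femto 4-volume version, below threshold**: for `s > 0` and `δ < 1/b₀` the weight `L³ · T_s · e^{−δβ}` (spatial volume × femto
time extent × one defect) is unbounded along the window. [folklore] -/
theorem femtoVolume_defect_unbounded {s δ lam : ℝ} (hs : 0 < s) (hδ : δ < 1 / b0) (hlam : 0 < lam) (M : ℝ) :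
    ∃ L1 : ℕ, ∀ (L : ℕ) [NeZero L], L1 ≤ L → ∀ β : ℝ, InFemtoWindow lam β L →
      M ≤ (L : ℝ) ^ 3 * (femtoSteps s β L : ℝ) * Real.exp (-(δ * β)) := by
  obtain ⟨L1, hL1⟩ := fourVolume_defect_unbounded hδ hlam (max M 0 * (2 * lam / s))
  refine ⟨L1, fun L _ hL β hW => ?_⟩
  have h := hL1 L hL β hW
  have hT := femtoSteps_ge_of_window hs.le hlam hW
  have h1 : (L : ℝ) ^ 3 * (s * L / (2 * lam)) * Real.exp (-(δ * β))
      ≤ (L : ℝ) ^ 3 * (femtoSteps s β L : ℝ) * Real.exp (-(δ * β)) :=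
    mul_le_mul_of_nonneg_right (mul_le_mul_of_nonneg_left hT (by positivity)) (Real.exp_pos _).le
  have h2 : (L : ℝ) ^ 3 * (s * L / (2 * lam)) * Real.exp (-(δ * β)) = (s / (2 * lam)) * ((L : ℝ) ^ 4 * Real.exp (-(δ * β))) := by
    ring
  have h3 : (s / (2 * lam)) * (max M 0 * (2 * lam / s)) = max M 0 := by
    field_simp
  have h4 : (s / (2 * lam)) * (max M 0 * (2 * lam / s)) ≤ (s / (2 * lam)) * ((L : ℝ) ^ 4 * Real.exp (-(δ * β))) :=
    mul_le_mul_of_nonneg_left h (by positivity)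
  calc M ≤ max M 0 := le_max_left _ _
    _ = _ := h3.symm
    _ ≤ _ := h4
    _ = _ := h2.symm
    _ ≤ _ := h1

/-- **Femto 4-volume version, above threshold**: for `s ≥ 0` and `δ > 1/b₀` the weight `L³ · T_s · e^{−δβ}` tends to `0` along the window
(`T_s ≤ (s/lam + 1) L`). [folklore] -/
theorem femtoVolume_defect_small {s δ lam ε : ℝ} (hs : 0 ≤ s) (hδ : 1 / b0 < δ) (hlam : 0 < lam) (hε : 0 < ε) :
    ∃ L1 : ℕ, ∀ (L : ℕ) [NeZero L], L1 ≤ L → ∀ β : ℝ, InFemtoWindow lam β L →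
      (L : ℝ) ^ 3 * (femtoSteps s β L : ℝ) * Real.exp (-(δ * β)) ≤ ε := by
  obtain ⟨L1, hL1⟩ := fourVolume_defect_small hδ hlam (show 0 < ε / (s / lam + 1) by positivity)
  refine ⟨L1, fun L _ hL β hW => ?_⟩
  have h := hL1 L hL β hW
  have hT := femtoSteps_le_of_window hs hlam hW
  have hL1' : (1 : ℝ) ≤ L := by exact_mod_cast NeZero.one_le
  have hT' : (femtoSteps s β L : ℝ) ≤ (s / lam + 1) * L := by
    have h0 : s / lam * L = s * L / lam := div_mul_eq_mul_div s lam L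
    have h0' : 0 ≤ s / lam := by positivity
    nlinarith [hT, h0, hL1', h0']
  have h1 : (L : ℝ) ^ 3 * (femtoSteps s β L : ℝ) * Real.exp (-(δ * β))
      ≤ (L : ℝ) ^ 3 * ((s / lam + 1) * L) * Real.exp (-(δ * β)) :=
    mul_le_mul_of_nonneg_right (mul_le_mul_of_nonneg_left hT' (by positivity)) (Real.exp_pos _).le
  have h2 : (L : ℝ) ^ 3 * ((s / lam + 1) * L) * Real.exp (-(δ * β)) = (s / lam + 1) * ((L : ℝ) ^ 4 * Real.exp (-(δ * β))) := by
    ring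
  have h3 : (s / lam + 1) * ((L : ℝ) ^ 4 * Real.exp (-(δ * β))) ≤ (s / lam + 1) * (ε / (s / lam + 1)) :=
    mul_le_mul_of_nonneg_left h (by positivity)
  have h4 : (s / lam + 1) * (ε / (s / lam + 1)) = ε := by
    field_simp
  linarith [h1, h2, h3, h4]

/-- ★ **Cutoff-scale large fields are abundant on the window**: for EVERY per-plaquette defect `0 ≤ δ ≤ 4 = 2N` (the most a single `SU(2)`
plaquette can cost), `L³ ≤ L⁴ e^{−δβ}` on `W(lam, L)` for all large `L` (`4 − 16b₀ − (1 − 16b₀) = 3`).  The union bound «plaquettes ×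
worst Boltzmann factor» certifies nothing at the cutoff scale on the window. [folklore] -/
theorem cutoffScale_defect_ge_cube {δ lam : ℝ} (hδ0 : 0 ≤ δ) (hδ : δ ≤ 4) (hlam : 0 < lam) :
    ∃ L1 : ℕ, ∀ (L : ℕ) [NeZero L], L1 ≤ L → ∀ β : ℝ, InFemtoWindow lam β L →
      (L : ℝ) ^ 3 ≤ (L : ℝ) ^ 4 * Real.exp (-(δ * β)) := by
  have hb0 : 0 < b0 := by unfold b0; positivity
  have h16 := sixteen_b0_lt_one
  obtain ⟨L1, hL1⟩ := fourVolume_defect_ge hδ0 (by linarith : (0 : ℝ) < 1 - 16 * b0) hlam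
  refine ⟨L1, fun L _ hL β hW => le_trans ?_ (hL1 L hL β hW)⟩
  have hL1' : (1 : ℝ) ≤ L := by exact_mod_cast NeZero.one_le
  have hδ' : b0 * δ ≤ b0 * 4 := mul_le_mul_of_nonneg_left hδ hb0.le
  calc (L : ℝ) ^ 3 = (L : ℝ) ^ ((3 : ℕ) : ℝ) := (Real.rpow_natCast _ 3).symm
    _ ≤ (L : ℝ) ^ (4 - 4 * b0 * δ - (1 - 16 * b0) : ℝ) := by
        apply Real.rpow_le_rpow_of_exponent_le hL1'
        push_cast
        nlinarith [hδ']

/-! ## §4 Contrast: at a FIXED lattice size the same weight vanishes as `β → ∞` (the S-BASE regime is entropy-free) -/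

/-- At fixed `L`, `L⁴ e^{−δβ} → 0` as `β → ∞` (`δ > 0`). [folklore] -/
theorem fourVolume_defect_tendsto_zero_fixedL (L : ℕ) {δ : ℝ} (hδ : 0 < δ) :
    Tendsto (fun β : ℝ => (L : ℝ) ^ 4 * Real.exp (-(δ * β))) atTop (𝓝 0) := by
  have h1 : Tendsto (fun β : ℝ => δ * β) atTop atTop := tendsto_id.const_mul_atTop hδ
  have h2 : Tendsto (fun β : ℝ => Real.exp (-(δ * β))) atTop (𝓝 0) :=
    Real.tendsto_exp_neg_atTop_nhds_zero.comp h1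
  simpa using h2.const_mul ((L : ℝ) ^ 4)

/-! ## §5 Non-vacuity -/

/-- The eventual statements of §3 are witnessed: for `δ < 1/b₀` and every depth `lam ∈ (0, 1]`, every `M` is exceeded by `L⁴e^{−δβ}` at
some window point (the window is inhabited on every lattice, `exists_inFemtoWindow`). [folklore] -/
theorem exists_window_point_ge {δ lam : ℝ} (hδ : δ < 1 / b0) (h0 : 0 < lam) (h1 : lam ≤ 1) (M : ℝ) :
    ∃ (L : ℕ) (β : ℝ), 0 < L ∧ InFemtoWindow lam β L ∧ M ≤ (L : ℝ) ^ 4 * Real.exp (-(δ * β)) := by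
  obtain ⟨L1, hL1⟩ := fourVolume_defect_unbounded hδ h0 M
  obtain ⟨β, hW, -⟩ := exists_inFemtoWindow (L1 + 1) h0 h1
  exact ⟨L1 + 1, β, Nat.succ_pos _, hW, hL1 (L1 + 1) (Nat.le_succ _) β hW⟩

end Summit.QuantumFields.YangMills.Theorems.TwistedTraceScaling.Negative.R80

end
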